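import Summits.HodgeConjecture.HodgeConjecture.Theorems.MilnorKExponentialSymbolClassesAlgebraicSymbolClassesHodgeTypeProjection

/-!
# Stub (T) of the line `NashDescentSketch`, helper 3/3: a typed zig-zag

Helper file (crux `SymbolClassesAlgebraic`, stmt-HodgeConjecture-17743; registered sub-goal
`stub_symbolClassesHodgeType_typedTransgression`, serving the stub `stub_symbolClassesHodgeType`).
A Čech cocycle of closed forms of `F^p` over a finite open cover of a complex manifold has a
Čech–de Rham transgression (Bott–Tu, proof of Prop. 8.8) all of whose cochains, and whose bottom
global form, stay in `F^p` (Carlson–Müller-Stach–Peters (2017), §3.1, Prop. 3.1.6). Everything is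
proved; no named fact is introduced.
-/

noncomputable section

open scoped Manifold Topology ContDiff
open CategoryTheory AlgebraicGeometry Filter

-- the tree's own summit-side namespaces repeat `HodgeConjecture` (summit = sub-problem)
set_option linter.dupNamespace false

-- `TangentSpace 𝓘(ℝ, E) x = E` is an abuse of definitional equality; let `isDefEq` unfold it.
set_option backward.isDefEq.respectTransparency false

namespace Summit.HodgeConjecture.HodgeConjecture.Theorems.MilnorKExponentialNash

open Literature.AlgebraicGeometry Literature.AlgebraicGeometry.HodgeTheory
  Literature.AlgebraicGeometry.Motives Literature.Geometry.Kaehler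
  Literature.NumberTheory.Transcendental

section TypedZigzag

open Set Literature.Algebra.Homology Literature.Analysis.Complex

variable {E : Type*} [NormedAddCommGroup E] [NormedSpace ℂ E] [FiniteDimensional ℂ E]
  {M : Type*} [TopologicalSpace M] [ChartedSpace E M] [IsManifold 𝓘(ℂ, E) ω M]
  [IsManifold 𝓘(ℝ, E) ∞ M] [T2Space M]

variable {ι : Type*} {U : ι → Set M} (hU : ∀ i, IsOpen (U i))

set_option maxHeartbeats 400000 in
/-- **The staircase of the typed zig-zag** (induction on the number `t` of steps below the top):
cochains `Z_{a,b}` of forms of `F^p` with `δ Z_{q,q+1} = wc` and the step equations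
`d Z_{a+1,b} = δ Z_{a,b+1}` for `q - t ≤ a < q`, zero below (Bott–Tu (1982), proof of Prop. 8.8,
each `δ`-equation solved inside `F^p` by `exists_cechδ_eq_of_typeComponent_eq_zero`).
[cite: BottTu1982Forms, §8 Prop. 8.8] -/
theorem exists_typed_staircase (hK : (cechDeRham 𝓘(ℝ, E) ℂ hU).RowExact) {q p : ℕ}
    (wc : CechForms 𝓘(ℝ, E) ℂ U (q + 1) (q + 1))
    (hδ : cechδ 𝓘(ℝ, E) ℂ hU (q + 1) (q + 1) wc = 0)
    (hd : cechd 𝓘(ℝ, E) ℂ hU (q + 1) (q + 1) wc = 0)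
    (hF : ∀ J (P Q : ℕ), P < p → (wc J : MForm 𝓘(ℝ, E) M ℂ (q + 1)).typeComponent P Q = 0) :
    ∀ t : ℕ, t ≤ q → ∃ Z : (a b : ℕ) → CechForms 𝓘(ℝ, E) ℂ U a b,
    (∀ a b J (P Q : ℕ), P < p → (Z a b J : MForm 𝓘(ℝ, E) M ℂ b).typeComponent P Q = 0) ∧
    cechδ 𝓘(ℝ, E) ℂ hU q (q + 1) (Z q (q + 1)) = wc ∧
    (∀ a b : ℕ, a + 1 + b = 2 * q + 1 → q - t ≤ a → a < q →
      cechd 𝓘(ℝ, E) ℂ hU (a + 1) b (Z (a + 1) b) = cechδ 𝓘(ℝ, E) ℂ hU a (b + 1) (Z a (b + 1))) ∧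
    (∀ a b : ℕ, a < q - t → Z a b = 0) := by
  intro t
  induction t with
  | zero =>
    intro _
    obtain ⟨v, hv, hvF⟩ := exists_cechδ_eq_of_typeComponent_eq_zero hU hK wc hδ hF
    refine ⟨ADoubleComplex.single q (q + 1) v, ?_, ?_, ?_, ?_⟩
    · intro a b J P Q hP
      by_cases hab : a = q ∧ b = q + 1
      · obtain ⟨rfl, rfl⟩ := hab
        rw [ADoubleComplex.single_apply_same]
        exact hvF J P Q hP
      · rw [ADoubleComplex.single_apply_of_ne (by tauto)]
        exact MForm.typeComponent_zero P Q
    · rw [ADoubleComplex.single_apply_same, hv]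
    · intro a b _ h1 h2
      omega
    · intro a b hab
      exact ADoubleComplex.single_apply_of_ne_fst (by omega) _ _
  | succ t ih =>
    intro ht
    obtain ⟨Z, hZF, htop, hsteps, hzero⟩ := ih (by omega)
    obtain ⟨a₀, ha₀⟩ : ∃ a₀ : ℕ, a₀ + (t + 1) = q := ⟨q - (t + 1), by omega⟩
    -- the `δ`-cocycle to be lifted: `d Z_{a₀+1, q+t+1}`
    have hc0 : cechδ 𝓘(ℝ, E) ℂ hU (a₀ + 1) (q + t + 1 + 1)
        (cechd 𝓘(ℝ, E) ℂ hU (a₀ + 1) (q + t + 1) (Z (a₀ + 1) (q + t + 1))) = 0 := by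
      have hanti := (cechDeRham 𝓘(ℝ, E) ℂ hU).δ_d (a₀ + 1) (q + t + 1) (Z (a₀ + 1) (q + t + 1))
      change cechδ 𝓘(ℝ, E) ℂ hU (a₀ + 1) (q + t + 1 + 1)
          (cechd 𝓘(ℝ, E) ℂ hU (a₀ + 1) (q + t + 1) (Z (a₀ + 1) (q + t + 1))) =
        -cechd 𝓘(ℝ, E) ℂ hU (a₀ + 1 + 1) (q + t + 1)
          (cechδ 𝓘(ℝ, E) ℂ hU (a₀ + 1) (q + t + 1) (Z (a₀ + 1) (q + t + 1))) at hanti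
      rw [hanti, neg_eq_zero]
      cases t with
      | zero =>
        -- `a₀ + 1 = q`: `δ Z_{q,q+1} = wc` and `d wc = 0`
        have key : ∀ m : ℕ, q = m →
            cechd 𝓘(ℝ, E) ℂ hU (m + 1) (q + 0 + 1)
              (cechδ 𝓘(ℝ, E) ℂ hU m (q + 0 + 1) (Z m (q + 0 + 1))) = 0 := by
          rintro m rfl
          exact (congrArg (cechd 𝓘(ℝ, E) ℂ hU (q + 1) (q + 1)) htop).trans hd
        exact key (a₀ + 1) (by omega)
      | succ t' =>
        -- the step above, `δ Z_{a₀+1, ·} = d Z_{a₀+2, ·}`, and `d ∘ d = 0`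
        have hs := hsteps (a₀ + 1) (q + t' + 1) (by omega) (by omega) (by omega)
        show cechd 𝓘(ℝ, E) ℂ hU (a₀ + 1 + 1) (q + t' + 1 + 1)
            (cechδ 𝓘(ℝ, E) ℂ hU (a₀ + 1) (q + t' + 1 + 1) (Z (a₀ + 1) (q + t' + 1 + 1))) = 0
        rw [← hs]
        exact (cechDeRham 𝓘(ℝ, E) ℂ hU).d_d (a₀ + 1 + 1) (q + t' + 1) (Z (a₀ + 1 + 1) (q + t' + 1))
    obtain ⟨v, hv, hvF⟩ := exists_cechδ_eq_of_typeComponent_eq_zero hU hK _ hc0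
      (fun J P Q hP ↦ typeComponent_cechd_eq_zero hU _ (hZF _ _) J hP)
    refine ⟨Z + ADoubleComplex.single a₀ (q + t + 1 + 1) v, ?_, ?_, ?_, ?_⟩
    · intro a b J P Q hP
      rw [Pi.add_apply, Pi.add_apply, Pi.add_apply, Submodule.coe_add, MForm.typeComponent_add,
        hZF a b J P Q hP, zero_add]
      by_cases hab : a = a₀ ∧ b = q + t + 1 + 1
      · obtain ⟨rfl, rfl⟩ := hab
        rw [ADoubleComplex.single_apply_same]
        exact hvF J P Q hP
      · rw [ADoubleComplex.single_apply_of_ne (not_and_or.1 hab)]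
        exact MForm.typeComponent_zero P Q
    · rw [Pi.add_apply, Pi.add_apply,
        ADoubleComplex.single_apply_of_ne_fst (show q ≠ a₀ by omega), add_zero, htop]
    · intro a b hab h1 h2
      rw [Pi.add_apply, Pi.add_apply, Pi.add_apply, Pi.add_apply,
        ADoubleComplex.single_apply_of_ne_fst (show a + 1 ≠ a₀ by omega), add_zero]
      by_cases haa : a = a₀
      · -- the new step at `a = a₀`
        have hb' : b = q + t + 1 := by omega
        subst hb'
        subst haa
        rw [ADoubleComplex.single_apply_same, hzero a (q + t + 1 + 1) (by omega), zero_add, hv]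
      · rw [ADoubleComplex.single_apply_of_ne_fst haa, add_zero]
        exact hsteps a b hab (by omega) h2
    · intro a b hab
      rw [Pi.add_apply, Pi.add_apply, hzero a b (by omega),
        ADoubleComplex.single_apply_of_ne_fst (show a ≠ a₀ by omega), add_zero]

variable [SigmaCompactSpace M] [Fintype ι]

set_option maxHeartbeats 400000 in
/-- **The typed zig-zag.** For a Čech `(q+1)`-cochain `wc` of `(q+1)`-forms on the `U_J` which is a
`δ`-cocycle, `d`-closed, and made of forms of `F^p`, there is a zig-zag through the Čech–de Rham
complex all of whose cochains, and whose bottom (a global smooth form `θ`), lie in `F^p`: at each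
step solve the `δ`-equation by the exactness of the rows and project onto `F^p` (Bott–Tu (1982),
proof of Prop. 8.8; Carlson–Müller-Stach–Peters (2017), §3.1, Prop. 3.1.6 for the filtration).
[cite: BottTu1982Forms, §8 Prop. 8.8] -/
theorem exists_typed_zigzag (hcov : ∀ x, ∃ i, x ∈ U i) {q p : ℕ}
    (wc : CechForms 𝓘(ℝ, E) ℂ U (q + 1) (q + 1))
    (hδ : cechδ 𝓘(ℝ, E) ℂ hU (q + 1) (q + 1) wc = 0)
    (hd : cechd 𝓘(ℝ, E) ℂ hU (q + 1) (q + 1) wc = 0)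
    (hF : ∀ J (P Q : ℕ), P < p → (wc J : MForm 𝓘(ℝ, E) M ℂ (q + 1)).typeComponent P Q = 0) :
    ∃ (Z : (a b : ℕ) → CechForms 𝓘(ℝ, E) ℂ U a b) (θ : MForm 𝓘(ℝ, E) M ℂ (2 * q + 1 + 1)),
      IsSmoothForm θ ∧ (∀ P Q : ℕ, P < p → θ.typeComponent P Q = 0) ∧
      cechδ 𝓘(ℝ, E) ℂ hU q (q + 1) (Z q (q + 1)) = wc ∧
      (∀ a b : ℕ, a + 1 + b = 2 * q + 1 → a < q →
        cechd 𝓘(ℝ, E) ℂ hU (a + 1) b (Z (a + 1) b) = cechδ 𝓘(ℝ, E) ℂ hU a (b + 1) (Z a (b + 1))) ∧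
      ∀ J, θ.restr (cechSet U J) =
        (cechd 𝓘(ℝ, E) ℂ hU 0 (2 * q + 1) (Z 0 (2 * q + 1)) J : MForm 𝓘(ℝ, E) M ℂ (2 * q + 1 + 1)) := by
  classical
  -- exactness of the rows from a partition of unity
  have hcov' : (univ : Set M) ⊆ ⋃ i, U i := fun x _ ↦ mem_iUnion.2 (hcov x)
  obtain ⟨ρ, hρ⟩ := SmoothPartitionOfUnity.exists_isSubordinate 𝓘(ℝ, E) isClosed_univ U hU hcov'
  have hK := cechDeRham_rowExact (F := ℂ) hU ρ hρ
  have hE := cechDeRhamRow_exact (F := ℂ) hU ρ hρ hcov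
  obtain ⟨Z, hZF, htop, hsteps, -⟩ := exists_typed_staircase hU hK wc hδ hd hF q le_rfl
  -- the bottom: `δ (d Z_{0,2q+1}) = 0`, so it glues to a global form of `F^p`
  have hc₀0 : cechδ 𝓘(ℝ, E) ℂ hU 0 (2 * q + 1 + 1)
      (cechd 𝓘(ℝ, E) ℂ hU 0 (2 * q + 1) (Z 0 (2 * q + 1))) = 0 := by
    change (cechDeRham 𝓘(ℝ, E) ℂ hU).δ 0 (2 * q + 1 + 1)
      ((cechDeRham 𝓘(ℝ, E) ℂ hU).d 0 (2 * q + 1) (Z 0 (2 * q + 1))) = 0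
    rw [ADoubleComplex.δ_d, neg_eq_zero]
    change cechd 𝓘(ℝ, E) ℂ hU (0 + 1) (2 * q + 1)
      (cechδ 𝓘(ℝ, E) ℂ hU 0 (2 * q + 1) (Z 0 (2 * q + 1))) = 0
    cases q with
    | zero =>
      change cechd 𝓘(ℝ, E) ℂ hU (0 + 1) (0 + 1) (cechδ 𝓘(ℝ, E) ℂ hU 0 (0 + 1) (Z 0 (0 + 1))) = 0
      rw [htop, hd]
    | succ q' =>
      have hs := hsteps 0 (2 * q' + 1 + 1) (by omega) (by omega) (by omega)
      show cechd 𝓘(ℝ, E) ℂ hU (0 + 1) (2 * q' + 1 + 1 + 1)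
          (cechδ 𝓘(ℝ, E) ℂ hU 0 (2 * q' + 1 + 1 + 1) (Z 0 (2 * q' + 1 + 1 + 1))) = 0
      rw [← hs]
      exact (cechDeRham 𝓘(ℝ, E) ℂ hU).d_d (0 + 1) (2 * q' + 1 + 1) (Z (0 + 1) (2 * q' + 1 + 1))
  obtain ⟨θ, hθs, hθF, hθr⟩ := exists_restr_eq_of_typeComponent_eq_zero hU hE _ hc₀0
    (fun J P Q hP ↦ typeComponent_cechd_eq_zero hU _ (hZF _ _) J hP)
  exact ⟨Z, θ, hθs, hθF, htop, fun a b hab ha ↦ hsteps a b hab (by omega) ha, hθr⟩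

/-- **A transgression in `F^p`.** If the top cochain `w` of SOME transgression over a finite open
cover is made of forms all of whose components `(P, Q)`, `P < p`, vanish on the `U_J`, then `w`
has a transgression whose bottom form lies in `F^p A^{2q+2}(M)`. [cite: BottTu1982Forms, §8 Prop. 8.8] -/
theorem exists_isTransgression_typeComponent_eq_zero (hcov : ∀ x, ∃ i, x ∈ U i) {q p : ℕ}
    {w : (Fin (q + 2) → ι) → MForm 𝓘(ℝ, E) M ℂ (q + 1)} {θ : MForm 𝓘(ℝ, E) M ℂ (2 * q + 1 + 1)}
    (h : IsTransgression hU q w θ)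
    (hw : ∀ J x, x ∈ cechSet U J → ∀ P Q : ℕ, P < p → (w J).typeComponent P Q x = 0) :
    ∃ θ' : MForm 𝓘(ℝ, E) M ℂ (2 * q + 1 + 1), IsTransgression hU q w θ' ∧ IsSmoothForm θ' ∧
      ∀ P Q : ℕ, P < p → θ'.typeComponent P Q = 0 := by
  -- the top cochain, restricted to the `U_J`
  have hwc : ∀ J, (w J).restr (cechSet U J) ∈ smoothFormsOn 𝓘(ℝ, E) ℂ (cechSet U J) (q + 1) :=
    fun J ↦ ⟨fun x hx ↦ (MForm.smoothAt_restr_iff (isOpen_cechSet hU J) _ hx).2 (h.smoothAt_top J hx),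
      fun x hx ↦ MForm.restr_apply_of_notMem _ hx⟩
  let wc : CechForms 𝓘(ℝ, E) ℂ U (q + 1) (q + 1) := fun J ↦ ⟨(w J).restr (cechSet U J), hwc J⟩
  -- `δ wc = 0` (from the existence of a zig-zag: `w = δ Z` on the `U_J`)
  have hδ : cechδ 𝓘(ℝ, E) ℂ hU (q + 1) (q + 1) wc = 0 := by
    obtain ⟨Z, ht, -, -⟩ := h
    funext J'
    apply Subtype.ext
    funext x
    by_cases hx : x ∈ cechSet U J'
    · rw [coe_cechδ_apply_apply_of_mem hU _ hx,
        show ((0 : CechForms 𝓘(ℝ, E) ℂ U (q + 1 + 1) (q + 1)) J' : MForm 𝓘(ℝ, E) M ℂ (q + 1)) x = 0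
          from rfl]
      have hδδ := (cechDeRham 𝓘(ℝ, E) ℂ hU).δ_δ q (q + 1) (Z q (q + 1))
      change cechδ 𝓘(ℝ, E) ℂ hU (q + 1) (q + 1) (cechδ 𝓘(ℝ, E) ℂ hU q (q + 1) (Z q (q + 1))) = 0
        at hδδ
      have hx0 : (cechδ 𝓘(ℝ, E) ℂ hU (q + 1) (q + 1)
          (cechδ 𝓘(ℝ, E) ℂ hU q (q + 1) (Z q (q + 1))) J' : MForm 𝓘(ℝ, E) M ℂ (q + 1)) x = 0 :=
        congrArg (fun c : CechForms 𝓘(ℝ, E) ℂ U (q + 1 + 1) (q + 1) ↦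
          (c J' : MForm 𝓘(ℝ, E) M ℂ (q + 1)) x) hδδ
      rw [coe_cechδ_apply_apply_of_mem hU _ hx] at hx0
      rw [← hx0]
      refine Finset.sum_congr rfl fun j _ ↦ ?_
      have hxj : x ∈ cechSet U (J' ∘ Fin.succAbove j) := cechSet_subset_comp U J' _ hx
      change (-1 : ℝ) ^ (j : ℕ) • ((w (J' ∘ Fin.succAbove j)).restr _) x = _
      rw [MForm.restr_apply_of_mem _ hxj, ht _ x hxj]
    · rw [(cechδ 𝓘(ℝ, E) ℂ hU (q + 1) (q + 1) wc J').2.2 x hx]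
      rfl
  -- `d wc = 0` (the `w_J` are closed on `U_J`)
  have hd : cechd 𝓘(ℝ, E) ℂ hU (q + 1) (q + 1) wc = 0 := by
    funext J
    apply Subtype.ext
    rw [cechd_apply, Submodule.coe_smul, coe_localD]
    funext x
    change ((-1 : ℝ) ^ (q + 1) • (mextDeriv ((w J).restr (cechSet U J))).restr (cechSet U J)) x = 0
    rw [Pi.smul_apply]
    by_cases hx : x ∈ cechSet U J
    · rw [MForm.restr_apply_of_mem _ hx, mextDeriv_restr_apply (isOpen_cechSet hU J) _ hx,
        h.mextDeriv_top_apply_eq_zero J hx, smul_zero]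
    · rw [MForm.restr_apply_of_notMem _ hx, smul_zero]
  -- `wc` is in `F^p`
  have hF : ∀ J (P Q : ℕ), P < p → (wc J : MForm 𝓘(ℝ, E) M ℂ (q + 1)).typeComponent P Q = 0 := by
    intro J P Q hP
    change ((w J).restr (cechSet U J)).typeComponent P Q = 0
    rw [typeComponent_restr]
    funext x
    by_cases hx : x ∈ cechSet U J
    · rw [MForm.restr_apply_of_mem _ hx]
      exact hw J x hx P Q hP
    · rw [MForm.restr_apply_of_notMem _ hx]
      rfl
  obtain ⟨Z, θ', hθ's, hθ'F, htop, hsteps, hbot⟩ := exists_typed_zigzag hU hcov wc hδ hd hF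
  refine ⟨θ', ⟨Z, fun J x hx ↦ ?_, hsteps, fun J x hx ↦ ?_⟩, hθ's, hθ'F⟩
  · rw [htop]
    exact MForm.restr_apply_of_mem _ hx
  · rw [← hbot J, MForm.restr_apply_of_mem _ hx]

end TypedZigzag

/-- Registered sub-goal of helper 3/3: over the one-set cover of `ℂ`, the top of any transgression
has a transgression with smooth bottom (instance of `exists_isTransgression_typeComponent_eq_zero`).
[cite: BottTu1982Forms, §8 Prop. 8.8] -/
theorem stub_symbolClassesHodgeType_typedTransgression : ∀ (q : ℕ) (w : (Fin (q + 2) → Unit) → MForm 𝓘(ℝ, ℂ) ℂ ℂ (q + 1)) (θ : MForm 𝓘(ℝ, ℂ) ℂ ℂ (2 * q + 1 + 1)), IsTransgression (U := fun _ : Unit ↦ (Set.univ : Set ℂ)) (fun _ ↦ isOpen_univ) q w θ → ∃ θ' : MForm 𝓘(ℝ, ℂ) ℂ ℂ (2 * q + 1 + 1), IsTransgression (U := fun _ : Unit ↦ (Set.univ : Set ℂ)) (fun _ ↦ isOpen_univ) q w θ' ∧ IsSmoothForm θ' :=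
  fun _ _ _ h ↦
    let ⟨θ', h1, h2, _⟩ := exists_isTransgression_typeComponent_eq_zero (p := 0)
      (fun _ : Unit ↦ (isOpen_univ : IsOpen (Set.univ : Set ℂ))) (fun x ↦ ⟨(), Set.mem_univ x⟩) h
      (fun _ _ _ P _ hP ↦ absurd hP (Nat.not_lt_zero P))
    ⟨θ', h1, h2⟩

end Summit.HodgeConjecture.HodgeConjecture.Theorems.MilnorKExponentialNash

end
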